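import Mathlib
import Summits.NavierStokesRegularity.NavierStokesRegularity.Theorems.ThreadingFluxHorizonTowerQuadraticGenerator
import Summits.NavierStokesRegularity.NavierStokesRegularity.Theorems.ThreadingFluxHorizonTowerMixedBracketCoreA
import Summits.NavierStokesRegularity.NavierStokesRegularity.Theorems.ThreadingFluxHorizonTowerFiniteTowerIsolation
import HarnessLib

/-!
# Crux `PoloidalLiouville` (stmt-NavierStokesRegularity-1222), crux idea «horizon-threading-tower» (ns-idea-15):
# THE QUADRATIC GENERATOR, II — the bracket table of `L`, `M`, `A = 35·π₄(L²)`, `B = 77·π₆(L³)`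

Support file (`--supports stmt-NavierStokesRegularity-1222`, helper; cell `ns-wall-extremal`, width hand ns-wall-eng-3 g5; 0 kit), toward
THM E «the finite tower `{2, 4, 6}` is coaxially zonal at order one».  Real coefficients (the loop bracket `detP a b = det(∇a, ∇b, x)`
and its Leibniz rule `detP_mul_right` live over `ℝ` in `…MixedBracketCoreA`).

In the Poisson algebra generated by the quadratic generator `L = xᵀQx`, `M = |Qx|²`, the Casimir `ρ = |x|²` and the cubic
`W = det(x, Qx, Q²x)` (file `…QuadraticGenerator`):
* `{L, M} = 4W`, `{ρ, ·} = 0`;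
* for ANY polynomial `P`, with `u = {P, L}`, `v = {P, M}`:  `{P, A} = 70 L u − 20 ρ v` and
  `{P, B} = 231 L² u − 84 ρ (L v + M u) + 14 τ ρ² u`;
* the table `{L, A} = −80 ρW`, `{M, A} = −280 LW`, `{L, B} = −336 ρLW`, `{M, B} = −924 L²W + 336 ρMW − 56 τρ²W`, and
  ★ `{A, B} = −560 ρ W (9L² + 12 ρM − 2τρ²)` — the bracket of the two top shells of a `{2,4,6}` tower VANISHES TO FIRST ORDER ONLY on the
  null cone (one factor `ρ`), its second digit is `W · L²`;
* ★ the CLOSED FORM of the order-one class identity of the tower `(P₂, c₁A, c₂B)` when `P₂ = σL + θM + κρ`: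
  `7ρ²{P₂, c₁A} + 18ρ{P₂, c₂B} + 11{c₁A, c₂B} = k₁ ρWL² + ρ²W(k_L L + k_M M) + k₀ ρ³W` with
  `k₁ = −16632 c₂θ − 55440 c₁c₂`, `k_L = −1960 c₁θ − 6048 c₂σ`, `k_M = 6048 c₂θ − 73920 c₁c₂`, `k₀ = −560 c₁σ − 1008 τc₂θ + 12320 τc₁c₂`.

HONEST LABEL: polynomial identities about one crux idea's typed objects; no Prop of the sketch is closed here; `HorizonTowerZonality`
(general towers), `PoloidalLiouville` (1222) OPEN; NS regularity NOT proved.  [folklore]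
-/

-- the summit and its single sub-problem share the name (CONVENTIONS §1)
set_option linter.dupNamespace false

noncomputable section

open MvPolynomial

namespace Summit.NavierStokesRegularity.NavierStokesRegularity.Theorems.PoloidalLiouville.HorizonTower.Zonal

variable (a b d e f : ℝ)

/-! ### The basic brackets -/

/-- `normSq` is the `ρ` of `…MixedBracketCoreA`. [folklore] -/
theorem normSq_eq : (normSq : RPoly) = X 0 ^ 2 + X 1 ^ 2 + X 2 ^ 2 := rfl

/-- `ρ` is a Casimir on the right: `{P, ρ} = 0`. [folklore] -/
theorem detP_normSq_right (P : RPoly) : detP P normSq = 0 := detP_rho P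

/-- `ρ` is a Casimir on the left: `{ρ, P} = 0`. [folklore] -/
theorem detP_normSq_left (P : RPoly) : detP normSq P = 0 := by
  rw [Zonal.detP_antisymm, detP_normSq_right, neg_zero]

/-- Leibniz on the left: `{PQ, A} = P{Q, A} + Q{P, A}`. [folklore] -/
theorem detP_mul_left (P Q A : RPoly) : detP (P * Q) A = P * detP Q A + Q * detP P A := by
  rw [Zonal.detP_antisymm, detP_mul_right, Zonal.detP_antisymm A Q, Zonal.detP_antisymm A P]; ring

/-- Additivity on the left. [folklore] -/
theorem detP_add_left (P Q A : RPoly) : detP (P + Q) A = detP P A + detP Q A := by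
  rw [Zonal.detP_antisymm, detP_add_right, Zonal.detP_antisymm A P, Zonal.detP_antisymm A Q]; ring

/-- Subtraction on the left. [folklore] -/
theorem detP_sub_left (P Q A : RPoly) : detP (P - Q) A = detP P A - detP Q A := by
  rw [Zonal.detP_antisymm, detP_sub_right, Zonal.detP_antisymm A P, Zonal.detP_antisymm A Q]; ring

/-- Constants on the left. [folklore] -/
theorem detP_C_mul_left (c : ℝ) (P A : RPoly) : detP (C c * P) A = C c * detP P A := by
  rw [Zonal.detP_antisymm, detP_C_mul_right, Zonal.detP_antisymm A P]; ring

/-- Constants are Casimirs (right). [folklore] -/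
theorem detP_C_right (P : RPoly) (c : ℝ) : detP P (C c) = 0 := by
  simp only [detP, pderiv_C, mul_zero, sub_self, add_zero]

/-- Constants are Casimirs (left). [folklore] -/
theorem detP_C_left (c : ℝ) (P : RPoly) : detP (C c) P = 0 := by
  rw [Zonal.detP_antisymm, detP_C_right, neg_zero]

/-- ★ `{L, M} = 4W` (`∇L = 2Qx`, `∇M = 2Q²x`). [folklore] -/
theorem detP_genL_genM : detP (genL a b d e f) (genM a b d e f) = C 4 * genW a b d e f := by
  rw [detP, pderiv_zero_genL, pderiv_one_genL, pderiv_two_genL, pderiv_zero_genM, pderiv_one_genM, pderiv_two_genM]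
  unfold genW
  simp only [map_ofNat]
  ring

/-- `{M, L} = −4W`. [folklore] -/
theorem detP_genM_genL : detP (genM a b d e f) (genL a b d e f) = -(C 4 * genW a b d e f) := by
  rw [Zonal.detP_antisymm, detP_genL_genM]

/-! ### Brackets with `A` and `B` for a general first slot -/

/-- `{P, A} = 70 L {P, L} − 20 ρ {P, M}`. [folklore] -/
theorem detP_genA_right (P : RPoly) : detP P (genA a b d e f)
    = C 70 * genL a b d e f * detP P (genL a b d e f) - C 20 * normSq * detP P (genM a b d e f) := by
  unfold genA
  simp only [detP_add_right, detP_sub_right, detP_mul_right, detP_normSq_right, detP_C_right, pow_succ, pow_zero, one_mul,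
    mul_zero, add_zero]
  simp only [map_ofNat]
  ring

/-- `{P, B} = 231 L² {P, L} − 84 ρ (L {P, M} + M {P, L}) + 14 τ ρ² {P, L}`. [folklore] -/
theorem detP_genB_right (P : RPoly) : detP P (genB a b d e f)
    = C 231 * genL a b d e f ^ 2 * detP P (genL a b d e f)
      - C 84 * normSq * (genL a b d e f * detP P (genM a b d e f) + genM a b d e f * detP P (genL a b d e f))
      + C (14 * genTau a b d e f) * normSq ^ 2 * detP P (genL a b d e f) := by
  unfold genB
  simp only [detP_add_right, detP_sub_right, detP_mul_right, detP_normSq_right, detP_C_right, pow_succ, pow_zero, one_mul,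
    mul_zero, add_zero]
  simp only [map_ofNat, map_mul]
  ring

/-! ### The table -/

/-- `{L, A} = −80 ρ W`. [folklore] -/
theorem detP_genL_genA : detP (genL a b d e f) (genA a b d e f) = -(C 80 * normSq * genW a b d e f) := by
  rw [detP_genA_right, detP_self, detP_genL_genM]; simp only [map_ofNat]; ring

/-- `{M, A} = −280 L W`. [folklore] -/
theorem detP_genM_genA : detP (genM a b d e f) (genA a b d e f) = -(C 280 * genL a b d e f * genW a b d e f) := by
  rw [detP_genA_right, detP_self, detP_genM_genL]; simp only [map_ofNat]; ring

/-- `{L, B} = −336 ρ L W`. [folklore] -/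
theorem detP_genL_genB : detP (genL a b d e f) (genB a b d e f) = -(C 336 * normSq * genL a b d e f * genW a b d e f) := by
  rw [detP_genB_right, detP_self, detP_genL_genM]; simp only [map_ofNat]; ring

/-- `{M, B} = −924 L² W + 336 ρ M W − 56 τ ρ² W`. [folklore] -/
theorem detP_genM_genB : detP (genM a b d e f) (genB a b d e f)
    = -(C 924 * genL a b d e f ^ 2 * genW a b d e f) + C 336 * normSq * genM a b d e f * genW a b d e f
      - C (56 * genTau a b d e f) * normSq ^ 2 * genW a b d e f := by
  rw [detP_genB_right, detP_self, detP_genM_genL]; simp only [map_ofNat, map_mul]; ring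

/-- ★ `{A, B} = −560 ρ W (9L² + 12ρM − 2τρ²)`: the bracket of the two top shells of a `{2,4,6}` tower has exactly ONE factor `ρ`.
[folklore] -/
theorem detP_genA_genB : detP (genA a b d e f) (genB a b d e f)
    = -(C 560 * normSq * genW a b d e f
        * (C 9 * genL a b d e f ^ 2 + C 12 * normSq * genM a b d e f - C (2 * genTau a b d e f) * normSq ^ 2)) := by
  have hL := detP_genL_genB a b d e f
  have hM := detP_genM_genB a b d e f
  unfold genA
  simp only [detP_add_left, detP_sub_left, detP_mul_left, detP_normSq_left, detP_C_left, hL, hM, pow_succ, pow_zero,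
    one_mul, mul_zero, add_zero]
  simp only [map_ofNat, map_mul]
  ring

/-! ### The closed form of the order-one class identity on the span of `L`, `M`, `ρ` -/

/-- Brackets of `P₂ = σL + θM + κρ` with `A`. [folklore] -/
theorem detP_span_genA (σ θ κ : ℝ) :
    detP (C σ * genL a b d e f + C θ * genM a b d e f + C κ * normSq) (genA a b d e f)
      = -(C (80 * σ) * normSq * genW a b d e f) - C (280 * θ) * genL a b d e f * genW a b d e f := by
  simp only [detP_add_left, detP_C_mul_left, detP_normSq_left, detP_genL_genA, detP_genM_genA, mul_zero, add_zero]
  simp only [map_ofNat, map_mul]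
  ring

/-- Brackets of `P₂ = σL + θM + κρ` with `B`. [folklore] -/
theorem detP_span_genB (σ θ κ : ℝ) :
    detP (C σ * genL a b d e f + C θ * genM a b d e f + C κ * normSq) (genB a b d e f)
      = -(C (336 * σ) * normSq * genL a b d e f * genW a b d e f)
        + C θ * (-(C 924 * genL a b d e f ^ 2 * genW a b d e f) + C 336 * normSq * genM a b d e f * genW a b d e f
          - C (56 * genTau a b d e f) * normSq ^ 2 * genW a b d e f) := by
  simp only [detP_add_left, detP_C_mul_left, detP_normSq_left, detP_genL_genB, detP_genM_genB, mul_zero, add_zero]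
  simp only [map_ofNat, map_mul]
  ring

/-- ★ **CLOSED FORM OF THE CLASS IDENTITY.**  For `P₂ = σL + θM + κρ`, `P₄ = c₁A`, `P₆ = c₂B`:
`7ρ²{P₂,P₄} + 18ρ{P₂,P₆} + 11{P₄,P₆} = k₁ ρWL² + ρ²W(k_L L + k_M M) + k₀ ρ³W`. [folklore] -/
theorem classIdentity_span (σ θ κ c₁ c₂ : ℝ) :
    C 7 * normSq ^ 2 * detP (C σ * genL a b d e f + C θ * genM a b d e f + C κ * normSq) (C c₁ * genA a b d e f)
      + C 18 * normSq * detP (C σ * genL a b d e f + C θ * genM a b d e f + C κ * normSq) (C c₂ * genB a b d e f)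
      + C 11 * detP (C c₁ * genA a b d e f) (C c₂ * genB a b d e f)
    = C (-(16632 * c₂ * θ) - 55440 * c₁ * c₂) * normSq * genW a b d e f * genL a b d e f ^ 2
      + normSq ^ 2 * genW a b d e f
        * (C (-(1960 * c₁ * θ) - 6048 * c₂ * σ) * genL a b d e f + C (6048 * c₂ * θ - 73920 * c₁ * c₂) * genM a b d e f)
      + C (-(560 * c₁ * σ) - 1008 * genTau a b d e f * c₂ * θ + 12320 * genTau a b d e f * c₁ * c₂)
        * normSq ^ 3 * genW a b d e f := by
  simp only [detP_C_mul_right, detP_C_mul_left, detP_span_genA, detP_span_genB, detP_genA_genB]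
  simp only [map_ofNat, map_mul, map_sub, map_neg, map_add]
  ring

/-! ### The class identity with a general quadratic shell: the digits through order `ρ³` -/

/-- ★ **EXPANSION OF THE CLASS IDENTITY for a general `P₂`** (`u = {P₂, L}`, `v = {P₂, M}`): after division by one factor `ρ`,
`7ρ²{P₂,c₁A} + 18ρ{P₂,c₂B} + 11{c₁A,c₂B} = ρ · E'` with
`E' = (4158 c₂ L² u − 55440 c₁c₂ L² W) + ρ (490 c₁ L u − 1512 c₂ (L v + M u) − 73920 c₁c₂ M W) + ρ² (−140 c₁ v + 252 τ c₂ u + 12320 τ c₁c₂ W)`.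
[folklore] -/
theorem classIdentity_expand (P : RPoly) (c₁ c₂ : ℝ) :
    C 7 * normSq ^ 2 * detP P (C c₁ * genA a b d e f) + C 18 * normSq * detP P (C c₂ * genB a b d e f)
      + C 11 * detP (C c₁ * genA a b d e f) (C c₂ * genB a b d e f)
    = normSq * ((C (4158 * c₂) * genL a b d e f ^ 2 * detP P (genL a b d e f)
        - C (55440 * c₁ * c₂) * genL a b d e f ^ 2 * genW a b d e f)
      + normSq * (C (490 * c₁) * genL a b d e f * detP P (genL a b d e f)
        - C (1512 * c₂) * (genL a b d e f * detP P (genM a b d e f) + genM a b d e f * detP P (genL a b d e f))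
        - C (73920 * c₁ * c₂) * genM a b d e f * genW a b d e f)
      + normSq ^ 2 * (-(C (140 * c₁) * detP P (genM a b d e f)) + C (252 * genTau a b d e f * c₂) * detP P (genL a b d e f)
        + C (12320 * genTau a b d e f * c₁ * c₂) * genW a b d e f)) := by
  rw [show detP (C c₁ * genA a b d e f) (C c₂ * genB a b d e f) = C c₁ * (C c₂ * detP (genA a b d e f) (genB a b d e f))
    by rw [detP_C_mul_left, detP_C_mul_right], detP_genA_genB]
  simp only [detP_C_mul_right, detP_genA_right, detP_genB_right]
  simp only [map_ofNat, map_mul]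
  ring

end Summit.NavierStokesRegularity.NavierStokesRegularity.Theorems.PoloidalLiouville.HorizonTower.Zonal

end
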